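import Literature.MathematicalPhysics.QuantumFieldTheory.Balaban1983to89.Step
import Literature.MathematicalPhysics.QuantumFieldTheory.Balaban1983to89.B15BasicStep

/-!
# `Balaban1983to89.TkOpsMarginal` — (2.19)–(2.22) [III] p.258 INHABITED by genuine integral operators:
`Step.TkOps.ofOneStep` / `Step.TkOps.laws_ofOneStep` instantiated over the composition monoid of positive fibre-integral
operators (`lmarginal`), the two one-step hypotheses `hfac` / `hcomm` PROVED from Fubini–Tonelli

CITATION HEADER (lean-in-tree rule 2026-08-18). T. Bałaban, *Convergent renormalization expansions for lattice gauge
theories*, Comm. Math. Phys. **119**, 243–285 (1988) [Balaban1988Convergent] (cell paper B14 = [III]; PDF page = journal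
page − 242), §2 p.258, (2.19)–(2.22); T. Bałaban, *Large field renormalization. I. The basic step of the 𝐑 operation*,
Comm. Math. Phys. **122**, 175–202 (1989) [Balaban1989LargeFieldI] (B15), (1.1) p.177, (1.2) p.178 (PDF page = journal page
− 174).  Every quotation below was checked against the page renders read as images (not the OCR).  Both papers are manuscripts
UNDER ADJUDICATION by the audit cell `pub-balaban`; NOTHING of them is asserted in this file — there is no `def … : Prop`
transcription used as a hypothesis and no cite-tagged assumption; every `theorem` below is elementary measure theory over
Mathlib's `lmarginal` (fibre integrals on a sigma-finite product of measure spaces) or list bookkeeping, kernel-checked,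
no `sorry`, no axiom beyond Mathlib's three.

WHAT IS PRINTED. [III] p.258: (2.19) *"If Z_k is represented as a union of disjoint regions, e.g. as a union of connected
components, Z_k = X₁ ∪ … ∪ X_n, X_i ∩ X_j = ∅ for i ≠ j, then 𝐓_k(Z_k) = Π_{i=1}^n 𝐓_k(X_i). The operations
corresponding to disjoint regions commute, i.e., 𝐓_k(X_i)𝐓_k(X_j) = 𝐓_k(X_j)𝐓_k(X_i)"*; (2.20) *"𝐓_k(X) =
Π^{0}_{j=k−1} 𝐓^{(j)}(Z_{j+1} ∩ X)"*, *"This is an ordered product, the order indicated in the product symbol"*;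
before (2.19): *"The last large field region is Z_k, and 𝐓_k is supported in it, in the sense that it involves integrations
and variables restricted to this region"*; after (2.20): *"The operation 𝐓^{(j)} involves integration with respect to the
gauge field variables V_j on Ω^c_{j+1} ∩ X, and with respect to the fluctuation field variables A_j on Z_{j+1} ∩ Ω_{j+1} ∩ X,
if the last set is nonempty"*; (2.21) its form when not changed by an 𝐑-operation: `∫dV_j⌈_{Ω^c_{j+1}∩X} δ(V̄_j V_{j+1}^{−1})
ζ(Ω^c_{j+1}) · ∫dA_j⌈_{Z_{j+1}∩Ω_{j+1}∩X} χ(Z_{j+1} ∩ Ω_{j+1} ∩ X) exp[quadratic form in A_j]`, followed by *"More precisely,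
the quadratic form in the exponential couples only the fields A_j in the same component of Z_{j+1} ∩ Ω_{j+1}. The other
terms of this quadratic form are included into the effective action into 𝐁-terms. If the operation 𝐓^{(j)} is changed by
an 𝐑-operation, then the general form (2.21) is preserved, but the characteristic functions are changed"*; (2.22)
*"𝐓_k(X) = Π^{m}_{j=k−1} 𝐓^{(j)}(Z_{j+1} ∩ X) 𝐓_m(Z_m ∩ X)"*.  B15 p.177: *"Thus we write the factorization property (2.19)
[III]"*, (1.1) `𝕋_k(Z_k) = 𝕋_k(Z_k ∩ Zᶜ)𝕋_k(Z) = 𝕋_k(Z_k ∩ Zᶜ) Π_{i=1}^m 𝕋_k(X_i)`, *"where Z = ⋃_{i=1}^m X_i is the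
decomposition into disjoint components"*; p.178: *"Using the conditions (i), (ii), and the factorization property (2.22)
[III], we write"* (1.2) `𝕋_k(Z) exp A_k = χ_k(Ω_k^{∼4}) Π^{h}_{j=k−1} 𝕋^{(j)}(Z_{j+1}) χ_h(Ω∖Ω^∼_{h+1}) 𝕋_h(Z_h) exp A_k`,
*"These operations are given by the formula (2.21) [III]"*.  The cell's structural file `…Balaban1983to89.Step` (unit
f2) types (2.19)/(2.20) as DATA + LAWS over an abstract monoid (`Step.TkOps`, `Step.TkOps.Laws`) and proves
`Step.TkOps.laws_ofOneStep`: the operations GENERATED by (2.20) satisfy (2.19) and the commutation, GIVEN two one-step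
facts `hfac` (each `𝐓^{(j)}` multiplicative on disjoint unions) and `hcomm` (one-step operations of disjoint regions
commute, across scales).  Cell STEP.md §11 O-D4 recorded that no module
instantiates `TkOps`/`TkOps.Laws` by actual operators.  This file does.

WHAT THIS FILE TYPES AND PROVES.
* `MDens π` — measurable `ℝ≥0∞`-valued functions of ALL variables `V : ∀ d, π d` (`δ`-indexed sigma-finite product: "all
  bond variables of all scales"); the monoid is `Function.End (MDens π)` (composition; Mathlib).
* `intOp μ s w hw : Function.End (MDens π)`, `F ↦ ∫⋯∫⁻_s, w·F ∂μ` — THE TEMPLATE of (2.21): integrate out the variables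
  `s` against a measurable weight `w`.  `intOp_comp` — THE one analytic input: for DISJOINT variable sets `s, t` and a weight
  `w_s` independent of the `t`-variables, `intOp s w_s ∘ intOp t w_t = intOp (s ∪ t) (w_s·w_t)` (Mathlib `lmarginal_union`
  = Tonelli on the finite product, + `B15.BasicStep.lmarginal_mul_of_indepOf`); `intOp_mono` (positivity/monotonicity).
* `LocalSystem ι δ π` — an abstract REGION-LOCAL system of one-step data: large-field regions `Z j : Set ι`, the variable
  set `vars j Y : Finset δ` and the weight `wt k j Y` of `𝐓^{(j)}(Y)` as it stands after step `k`, with the axioms (for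
  sub-regions of the relevant `Z_{j+1}` only): variable sets additive and disjoint on disjoint regions (also across
  scales), weights multiplicative on disjoint regions of one scale and independent of the variables of a disjoint region.
  `LocalSystem.T1` = the one-step operations `intOp μ (vars j Y) (wt k j Y)`, `LocalSystem.ops := Step.TkOps.ofOneStep Z T1`
  = the operations `𝐓_k(X)` DEFINED by (2.20).
* `LocalSystem.hfac`, `LocalSystem.hcomm` — the two hypotheses of `Step.TkOps.laws_ofOneStep` — PROVED (`intOp_comp` +
  `intOp_congr`); hence `LocalSystem.laws : ∀ k, (S.ops μ).Laws k` — (2.19), the commutation and (2.20) for EVERY `k`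
  with NO hypothesis left at the one-step level beyond region-locality; `LocalSystem.prod222` — (2.22) via
  `Step.TkOps.prod222` under the nesting `Z_{j+1} ⊆ Z_m (j < m)`; `LocalSystem.T_mono` — every `𝐓_k(X)` is a monotone
  positive operator on measurable densities; `LocalSystem.ops_T_two` — the two-scale formula by `rfl`.
* `toy` — a NON-VACUOUS instance: scales `Fin N`, sites `ι` (finite), one variable per (scale, site) with values in any
  measurable space `Ω`, `vars j Y` = the variables `(j, y), y ∈ Y`, weight = `Π_{y ∈ Y} w(V(j,y))` for one measurable
  `w : Ω → ℝ≥0∞` (e.g. a small-field indicator); all eight fields discharged, and an `example` over `(ℝ, volume)`, `ι = Fin 5`,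
  `w = 𝟙_{[−1,1]}` shows every instance argument resolves: `TkOps.Laws k` is inhabited by integral operators for all `k`.

HONEST FRAMING (cell ABSOLUTE RULE).  This file asserts NOTHING about Bałaban's actual operations.  NOT typed: (2.21)'s
characteristic functions `χ_j`, its densities `exp[…]`, the gauge-covariant averaging structure, the 𝐑-modified one-step
operations of §3 [III] (cell STEP.md 6.16 (c)/(d): the one-step operation of the T-step is (3.23) p.270, of (1.29)-shape
with `z^{(k)}`, not the literal (2.21)); the probability normalisation of the fibres is not needed and not assumed (sigma-
finite suffices).  What IS proved is the structural statement O-D4 asked for: ANY region-local system of fibre integrals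
generates, by (2.20), operations satisfying (2.19) and the commutation, the only analytic content being Fubini–Tonelli.
CAVEAT ON "DISJOINT": for the literal (2.21) the weight of `𝐓^{(j)}(A)` may depend on variables near `∂A`, so the axioms
`wt_indep` / `wt_union` / `vars_disjoint` are faithful for SEPARATED regions — unions of distinct connected components of
`Z_k`, which is what (2.19) names (*"e.g. as a union of connected components"*) and what p.258 prints after (2.21)
(*"the quadratic form in the exponential couples only the fields A_j in the same component of Z_{j+1} ∩ Ω_{j+1}"*); an
instance modelling [III] takes `ι` = the set of connected components (or of partition cubes carrying the separation), so
that `Disjoint` means separated.  The index `k` of `wt`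
("as it stands after step k", `Step.TkOps.T1`) is carried but plays no role in the proofs.

VERSIONS. v1 = p186750 (commit cf2adc60ebd8).  v1.0.1 = DOCSTRING-ONLY DOCFIX found by the author's own render check
(before any cross-read): v1 cited *"B15 (1.2) p.177"* with a paraphrase `∫dV_j⌈_{Z_j} χ_j …` that B15 does not print —
(1.2) is on p.178 and is the (2.22)-type factorization quoted above, (1.1) p.177 restates (2.19) — and v1 supported the
"separated regions" caveat by [III] p.256 ll.10–12 (*"the distance between their boundaries is at least equal to 2MR_j"*),
which concerns the domains `Ω_j, Λ_j`, not the components of `Z_k`; both replaced by the verbatim p.258 / p.177 / p.178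
quotations above.  Declarations byte-identical to v1.

Unit `b2b-balaban-b01` (PAPER SUB-CELL B01 = P15/B15 fallback lineage), self-row STEP-OD4-TKOPS-MARGINAL (journal
2026-08-19 l.50409; source: f2 NOTE l.49800, STEP.md v11.19 §11 O-D4).  Imports `…Step` (unit f2: `TkOps`, `TkOps.ofOneStep`,
`TkOps.laws_ofOneStep`, `TkOps.prod222`, `TkOps.tail`) and `…B15BasicStep` (this unit: `IndepOf`, `lmarginal_mul_of_indepOf`)
and modifies neither.  Census: GAPS.md C-b01g20-3; STEP.md §11 O-D4.
-/

open scoped BigOperators ENNReal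
open _root_.MeasureTheory Function Finset

namespace Literature.MathematicalPhysics.QuantumFieldTheory.Balaban1983to89.TkOpsMarginal

open Literature.MathematicalPhysics.QuantumFieldTheory.Balaban1983to89.Step
open Literature.MathematicalPhysics.QuantumFieldTheory.Balaban1983to89.B15.BasicStep

/-! ### Part 1. The monoid of positive fibre-integral operators and the Fubini composition law -/

section Operators

variable {δ : Type*} {π : δ → Type*} [∀ d, MeasurableSpace (π d)]

/-- Measurable `ℝ≥0∞`-valued functions of ALL the variables `V : ∀ d, π d` — the densities / functionals the operations
act on (B15 (1.2) p.178: `𝕋_k(Z)` applied to `exp A_k`).  The composition monoid `Function.End (MDens π)` is the `M` of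
`Step.TkOps`. [folklore] -/
abbrev MDens (π : δ → Type*) [∀ d, MeasurableSpace (π d)] := {f : (∀ d, π d) → ℝ≥0∞ // Measurable f}

/-- Multiplication in `Function.End` is composition, right factor acting first. [folklore] -/
theorem end_mul_apply (S T : Function.End (MDens π)) (F : MDens π) : (S * T) F = S (T F) := rfl

/-- `IsMono T`: the operator `T` preserves the pointwise order of densities (positivity of an integral operator in the
form used downstream: bounds propagate through `𝐓_k(X)`). [folklore] -/
def IsMono (T : Function.End (MDens π)) : Prop := ∀ F G : MDens π, F.1 ≤ G.1 → (T F).1 ≤ (T G).1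

/-- The identity operator is monotone. [folklore] -/
theorem isMono_one : IsMono (1 : Function.End (MDens π)) := fun _ _ h => h

/-- Composition of monotone operators is monotone. [folklore] -/
theorem IsMono.mul {S T : Function.End (MDens π)} (hS : IsMono S) (hT : IsMono T) : IsMono (S * T) :=
  fun F G h => hS _ _ (hT F G h)

/-- An ordered product of monotone operators is monotone. [folklore] -/
theorem isMono_list_prod (l : List (Function.End (MDens π))) (h : ∀ T ∈ l, IsMono T) : IsMono l.prod := by
  induction l with
  | nil => exact isMono_one
  | cons a l ih =>
    rw [List.prod_cons]
    exact (h a (by simp)).mul (ih fun T hT => h T (by simp [hT]))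

variable [DecidableEq δ] (μ : ∀ d, Measure (π d)) [∀ d, SigmaFinite (μ d)]

/-- The positive integral operator `F ↦ ∫⋯∫⁻_s, w·F ∂μ`: integrate out the variables indexed by `s` against the measurable
weight `w`, as an element of the composition monoid `Function.End (MDens π)` (measurability of the result: Mathlib
`Measurable.lmarginal`).  This is the SHAPE of (2.21) [III] p.258 (integration of the variables restricted to the region
against characteristic functions × the exponential of a quadratic form; B15 p.178: *"These operations are given by the
formula (2.21) [III]"*); the concrete `δ`, `ζ`, `χ` and quadratic forms are NOT typed. [cite: Balaban1988Convergent, (2.21) p.258] -/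
noncomputable def intOp (s : Finset δ) (w : (∀ d, π d) → ℝ≥0∞) (hw : Measurable w) : Function.End (MDens π) :=
  fun F => ⟨∫⋯∫⁻_s, w * F.1 ∂μ, (hw.mul F.2).lmarginal μ⟩

/-- Pointwise formula of `intOp`. [folklore] -/
@[simp] theorem intOp_apply (s : Finset δ) (w : (∀ d, π d) → ℝ≥0∞) (hw : Measurable w) (F : MDens π) :
    ((intOp μ s w hw) F).1 = ∫⋯∫⁻_s, w * F.1 ∂μ := rfl

/-- `intOp` depends on the data `(s, w)` only (the measurability certificate is proof-irrelevant). [folklore] -/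
theorem intOp_congr {s s' : Finset δ} {w w' : (∀ d, π d) → ℝ≥0∞} (hw : Measurable w) (hw' : Measurable w')
    (hs : s = s') (hww : w = w') : intOp μ s w hw = intOp μ s' w' hw' := by
  subst hs hww
  rfl

/-- Fibre integration against a nonnegative weight is monotone (`lmarginal_mono`). [folklore] -/
theorem intOp_mono (s : Finset δ) (w : (∀ d, π d) → ℝ≥0∞) (hw : Measurable w) : IsMono (intOp μ s w hw) :=
  fun _ _ h => lmarginal_mono (fun V => mul_le_mul_right (h V) (w V))

/-- **Fubini–Tonelli for the template** — the one analytic input of this file.  For DISJOINT variable sets `s, t` and a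
weight `w_s` that does not depend on the `t`-variables, integrating out `t` (weight `w_t`) and then `s` (weight `w_s`) is
the single fibre integral over `s ∪ t` with weight `w_s·w_t`:  `intOp s w_s ∘ intOp t w_t = intOp (s ∪ t) (w_s·w_t)`.
Mathlib `lmarginal_union` (Tonelli on the finite product `Measure.pi`) + `B15.BasicStep.lmarginal_mul_of_indepOf`
(a fibre-independent factor pulls out of the fibre integral). [folklore] -/
theorem intOp_comp {s t : Finset δ} (hst : Disjoint s t) {ws wt : (∀ d, π d) → ℝ≥0∞} (hws : Measurable ws)
    (hwt : Measurable wt) (hind : IndepOf t ws) :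
    intOp μ s ws hws * intOp μ t wt hwt = intOp μ (s ∪ t) (ws * wt) (hws.mul hwt) := by
  funext F
  apply Subtype.ext
  show ∫⋯∫⁻_s, ws * (∫⋯∫⁻_t, wt * F.1 ∂μ) ∂μ = ∫⋯∫⁻_s ∪ t, ws * wt * F.1 ∂μ
  rw [lmarginal_union μ _ ((hws.mul hwt).mul F.2) hst, mul_assoc, lmarginal_mul_of_indepOf t hind (hwt.mul F.2)]

end Operators

/-! ### Part 2. Region-local systems of one-step data and the generated operations `𝐓_k(X)` of (2.20) -/

section Local

variable {ι δ : Type*} [DecidableEq δ] {π : δ → Type*} [∀ d, MeasurableSpace (π d)]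

/-- An abstract REGION-LOCAL system of one-step integral operations over regions `Set ι` (all regions inside one ambient
point type, as in `Step.TkOps`) and variables `δ`: `Z j` the large-field regions, `vars j Y` the variables integrated by
`𝐓^{(j)}(Y)`, `wt k j Y` its weight (density × characteristic functions) as it stands after step `k`; axioms, each only for
sub-regions of the relevant `Z_{j+1}` / `Z_{i+1}`: measurable weights; variable sets additive and disjoint on disjoint
regions (also across scales); weights multiplicative on disjoint regions of one scale and independent of the variables of a
disjoint region.  This is the TEMPLATE of (2.21) [III] p.258, faithful for SEPARATED regions (unions
of distinct connected components; see the module docstring's caveat); it is an interface — existence of instances is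
`toy` below, Bałaban's instance is NOT constructed here. [cite: Balaban1988Convergent, (2.19)–(2.21) p.258] -/
structure LocalSystem (ι δ : Type*) [DecidableEq δ] (π : δ → Type*) [∀ d, MeasurableSpace (π d)] where
  /-- the large-field regions `Z_j` -/
  Z : ℕ → Set ι
  /-- the variables integrated out by the one-step operation of scale `j` localized in `Y` -/
  vars : ℕ → Set ι → Finset δ
  /-- the weight of `𝐓^{(j)}(Y)` as it stands after step `k` -/
  wt : ℕ → ℕ → Set ι → (∀ d, π d) → ℝ≥0∞
  /-- every weight is measurable -/
  wt_meas : ∀ k j (Y : Set ι), Measurable (wt k j Y)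
  /-- locality of the variables, one scale: the variables of a disjoint union inside `Z_{j+1}` are the union -/
  vars_union : ∀ j (A B : Set ι), A ⊆ Z (j + 1) → B ⊆ Z (j + 1) → Disjoint A B →
    vars j (A ∪ B) = vars j A ∪ vars j B
  /-- locality of the variables, any two scales: disjoint regions carry disjoint variable sets -/
  vars_disjoint : ∀ i j (A B : Set ι), A ⊆ Z (i + 1) → B ⊆ Z (j + 1) → Disjoint A B →
    Disjoint (vars i A) (vars j B)
  /-- locality of the weights, one scale: the weight of a disjoint union inside `Z_{j+1}` is the product -/
  wt_union : ∀ k j (A B : Set ι), A ⊆ Z (j + 1) → B ⊆ Z (j + 1) → Disjoint A B →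
    wt k j (A ∪ B) = wt k j A * wt k j B
  /-- locality of the weights, any two scales: the weight of `A` does not depend on the variables of a disjoint `B` -/
  wt_indep : ∀ k i j (A B : Set ι), A ⊆ Z (i + 1) → B ⊆ Z (j + 1) → Disjoint A B →
    IndepOf (vars j B) (wt k i A)

namespace LocalSystem

variable (S : LocalSystem ι δ π) (μ : ∀ d, Measure (π d)) [∀ d, SigmaFinite (μ d)]

/-- The one-step operations `𝐓^{(j)}(Y)` (after step `k`) of the system: fibre integration of the variables `vars j Y`
against the weight `wt k j Y` — the shape of (2.21). [cite: Balaban1988Convergent, (2.21) p.258] -/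
noncomputable def T1 (k j : ℕ) (Y : Set ι) : Function.End (MDens π) :=
  intOp μ (S.vars j Y) (S.wt k j Y) (S.wt_meas k j Y)

/-- The operations `𝐓_k(X)` of the system, DEFINED by (2.20) from its one-step operations: `Step.TkOps.ofOneStep`. [cite: Balaban1988Convergent, (2.20) p.258] -/
noncomputable def ops : TkOps ι (Function.End (MDens π)) :=
  TkOps.ofOneStep S.Z (S.T1 μ)

/-- The explicit formula (2.20) of the generated operations: `𝐓_k(X) = 𝐓^{(k−1)}(Z_k ∩ X) ∘ ⋯ ∘ 𝐓^{(0)}(Z_1 ∩ X)`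
(scale `0` integrated first). [cite: Balaban1988Convergent, (2.20) p.258] -/
theorem ops_T (k : ℕ) (X : Set ι) :
    (S.ops μ).T k X = (((List.range k).reverse).map fun j => S.T1 μ k j (S.Z (j + 1) ∩ X)).prod := rfl

/-- Two-scale sanity check of the order of integrations, by `rfl`:
`𝐓_2(X) F = ∫_{vars 1 (Z_2 ∩ X)} wt · (∫_{vars 0 (Z_1 ∩ X)} wt · F)`. [folklore] -/
theorem ops_T_two (X : Set ι) (F : MDens π) :
    (((S.ops μ).T 2 X) F).1 = ∫⋯∫⁻_(S.vars 1 (S.Z 2 ∩ X)), S.wt 2 1 (S.Z 2 ∩ X) *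
      (∫⋯∫⁻_(S.vars 0 (S.Z 1 ∩ X)), S.wt 2 0 (S.Z 1 ∩ X) * F.1 ∂μ) ∂μ := rfl

/-- Every generated `𝐓_k(X)` is a monotone positive operator on measurable densities (an ordered product of fibre
integrals against nonnegative weights). [folklore] -/
theorem T_mono (k : ℕ) (X : Set ι) : IsMono ((S.ops μ).T k X) := by
  rw [ops_T]
  refine isMono_list_prod _ fun T hT => ?_
  obtain ⟨j, _, rfl⟩ := List.mem_map.mp hT
  exact intOp_mono μ _ _ _

/-- `hfac` of `Step.TkOps.laws_ofOneStep`, PROVED: each one-step operation is multiplicative on disjoint unions inside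
`Z_{j+1}` — `𝐓^{(j)}(A ∪ B) = 𝐓^{(j)}(A) 𝐓^{(j)}(B)` — by `intOp_comp` (Fubini) and the locality axioms. [folklore] -/
theorem hfac (k : ℕ) : ∀ j, j < k → ∀ A B : Set ι, A ⊆ S.Z (j + 1) → B ⊆ S.Z (j + 1) → Disjoint A B →
    S.T1 μ k j (A ∪ B) = S.T1 μ k j A * S.T1 μ k j B := by
  intro j _ A B hA hB hAB
  simp only [T1]
  rw [intOp_comp μ (S.vars_disjoint j j A B hA hB hAB) (S.wt_meas k j A) (S.wt_meas k j B)
    (S.wt_indep k j j A B hA hB hAB)]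
  exact intOp_congr μ _ _ (S.vars_union j A B hA hB hAB) (S.wt_union k j A B hA hB hAB)

/-- `hcomm` of `Step.TkOps.laws_ofOneStep`, PROVED: one-step operations of disjoint regions commute, also across scales
(*"The operations corresponding to disjoint regions commute"*, p.258, at the one-step level) — both orders equal the single
fibre integral over the union of the two variable sets with the product weight. [folklore] -/
theorem hcomm (k : ℕ) : ∀ i, i < k → ∀ j, j < k → ∀ A B : Set ι, A ⊆ S.Z (i + 1) → B ⊆ S.Z (j + 1) →
    Disjoint A B → S.T1 μ k i A * S.T1 μ k j B = S.T1 μ k j B * S.T1 μ k i A := by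
  intro i _ j _ A B hA hB hAB
  simp only [T1]
  rw [intOp_comp μ (S.vars_disjoint i j A B hA hB hAB) (S.wt_meas k i A) (S.wt_meas k j B)
      (S.wt_indep k i j A B hA hB hAB),
    intOp_comp μ (S.vars_disjoint j i B A hB hA hAB.symm) (S.wt_meas k j B) (S.wt_meas k i A)
      (S.wt_indep k j i B A hB hA hAB.symm)]
  exact intOp_congr μ _ _ (Finset.union_comm _ _) (mul_comm _ _)

/-- **(2.19), the commutation and (2.20) for EVERY `k`, with no hypothesis left**: the operations generated by (2.20)
from ANY region-local system of fibre integrals satisfy `Step.TkOps.Laws k` — `Step.TkOps.laws_ofOneStep` with `hfac`,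
`hcomm` discharged.  `TkOps.Laws` is thereby inhabited by genuine integral operators (cell STEP.md §11 O-D4).
[cite: Balaban1988Convergent, (2.19)–(2.20) p.258] -/
theorem laws (k : ℕ) : (S.ops μ).Laws k :=
  TkOps.laws_ofOneStep S.Z (S.T1 μ) k (S.hfac μ k) (S.hcomm μ k)

/-- (2.19) spelled out: for disjoint `X, Y ⊆ Z_k`, `𝐓_k(X ∪ Y) = 𝐓_k(X) 𝐓_k(Y) = 𝐓_k(Y) 𝐓_k(X)`. [cite: Balaban1988Convergent, (2.19) p.258] -/
theorem factor219 (k : ℕ) (X Y : Set ι) (hX : X ⊆ S.Z k) (hY : Y ⊆ S.Z k) (hXY : Disjoint X Y) :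
    (S.ops μ).T k (X ∪ Y) = (S.ops μ).T k X * (S.ops μ).T k Y ∧
      (S.ops μ).T k X * (S.ops μ).T k Y = (S.ops μ).T k Y * (S.ops μ).T k X :=
  ⟨(S.laws μ k).factor219 X Y hX hY hXY, (S.laws μ k).comm219 X Y hX hY hXY⟩

/-- (2.22) for the system: `𝐓_k(X) = Π_{j=k−1}^{m} 𝐓^{(j)}(Z_{j+1} ∩ X) · 𝐓_m(Z_m ∩ X)` under the nesting
`Z_{j+1} ⊆ Z_m (j < m)` — `Step.TkOps.prod222` applied to `laws`. [cite: Balaban1988Convergent, (2.22) p.258] -/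
theorem prod222 {k m : ℕ} (hmk : m ≤ k) (hZ : ∀ j, j < m → S.Z (j + 1) ⊆ S.Z m) (X : Set ι) (hX : X ⊆ S.Z k) :
    (S.ops μ).T k X = (((List.Ico m k).reverse).map fun j => S.T1 μ k j (S.Z (j + 1) ∩ X)).prod *
      (S.ops μ).tail k m (S.Z m ∩ X) :=
  TkOps.prod222 (S.ops μ) (S.laws μ k) hmk hZ X hX

end LocalSystem

end Local

/-! ### Part 3. Non-vacuity: an ultra-local instance -/

section Toy

variable (N : ℕ) (ι : Type*) [Fintype ι] {Ω : Type*} [MeasurableSpace Ω]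

open Classical in
/-- Toy variable sets: the variables `(j, y)`, `y ∈ Y`, of scale `j < N` (one variable per scale and site). [folklore] -/
noncomputable def toyVars (j : ℕ) (Y : Set ι) : Finset (Fin N × ι) :=
  Finset.univ.filter fun d => (d.1 : ℕ) = j ∧ d.2 ∈ Y

/-- Membership in `toyVars`. [folklore] -/
@[simp] theorem mem_toyVars (j : ℕ) (Y : Set ι) (d : Fin N × ι) :
    d ∈ toyVars N ι j Y ↔ (d.1 : ℕ) = j ∧ d.2 ∈ Y := by
  simp [toyVars]

/-- `toyVars` of disjoint regions are disjoint, at any two scales. [folklore] -/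
theorem toyVars_disjoint (i j : ℕ) {A B : Set ι} (hAB : Disjoint A B) :
    Disjoint (toyVars N ι i A) (toyVars N ι j B) := by
  rw [Finset.disjoint_left]
  intro d h1 h2
  rw [mem_toyVars] at h1 h2
  exact Set.disjoint_left.1 hAB h1.2 h2.2

variable [DecidableEq ι]

/-- `toyVars` is additive on unions. [folklore] -/
theorem toyVars_union (j : ℕ) (A B : Set ι) : toyVars N ι j (A ∪ B) = toyVars N ι j A ∪ toyVars N ι j B := by
  ext d
  simp only [mem_toyVars, Finset.mem_union, Set.mem_union]
  tauto

variable (w : Ω → ℝ≥0∞)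

/-- Toy weights: the product over the variables of `toyVars j Y` of one single-variable weight `w` (e.g. the indicator of
a small-field condition). [folklore] -/
noncomputable def toyWt (j : ℕ) (Y : Set ι) (V : Fin N × ι → Ω) : ℝ≥0∞ :=
  ∏ d ∈ toyVars N ι j Y, w (V d)

/-- THE ULTRA-LOCAL TOY INSTANCE of `LocalSystem`: scales `Fin N`, finite sites `ι`, one `Ω`-valued variable per
(scale, site), `vars j Y = {(j, y) : y ∈ Y}`, weight `Π_{y ∈ Y} w(V(j, y))`, arbitrary regions `Z`.  All eight fields are
discharged, so the interface is consistent and `LocalSystem.laws` is not vacuous. [folklore] -/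
noncomputable def toy (hw : Measurable w) (Z : ℕ → Set ι) : LocalSystem ι (Fin N × ι) (fun _ => Ω) where
  Z := Z
  vars := toyVars N ι
  wt _ j Y := toyWt N ι w j Y
  wt_meas _ j Y := by
    show Measurable fun V : Fin N × ι → Ω => ∏ d ∈ toyVars N ι j Y, w (V d)
    exact Finset.measurable_prod _ fun d _ => hw.comp (measurable_pi_apply d)
  vars_union j A B _ _ _ := toyVars_union N ι j A B
  vars_disjoint i j A B _ _ hAB := toyVars_disjoint N ι i j hAB
  wt_union k j A B _ _ hAB := by
    funext V
    simp only [toyWt, Pi.mul_apply]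
    rw [toyVars_union, Finset.prod_union (toyVars_disjoint N ι j j hAB)]
  wt_indep k i j A B _ _ hAB := by
    intro x y
    refine Finset.prod_congr rfl fun d hd => ?_
    have hd' : d ∉ toyVars N ι j B := Finset.disjoint_left.1 (toyVars_disjoint N ι i j hAB) hd
    simp [updateFinset, hd']

/-- Non-vacuity, stated: the toy system's operations satisfy `Step.TkOps.Laws k` for every `k` and every sigma-finite
single-variable measure. [folklore] -/
theorem toy_laws (hw : Measurable w) (Z : ℕ → Set ι) (ν : Measure Ω) [SigmaFinite ν] (k : ℕ) :
    ((toy N ι w hw Z).ops fun _ => ν).Laws k :=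
  (toy N ι w hw Z).laws _ k

/-- Concrete closed instance: real variables with Lebesgue measure, five sites, small-field indicator weight `𝟙_{[−1,1]}`. -/
example (N : ℕ) (Z : ℕ → Set (Fin 5)) (k : ℕ) :
    ((toy N (Fin 5) (Set.indicator (Set.Icc (-1 : ℝ) 1) 1) (measurable_one.indicator measurableSet_Icc) Z).ops
      fun _ => (volume : Measure ℝ)).Laws k :=
  toy_laws N (Fin 5) _ _ Z volume k

end Toy

end Literature.MathematicalPhysics.QuantumFieldTheory.Balaban1983to89.TkOpsMarginal
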